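import Literature.Probability.Percolation.FivePointSixChange
import HarnessLib

/-!
# Five-point boundary data: FOUR of the five boundary classes are MONOTONE along each arc

Topic `Literature/Probability/Percolation`; five-point lineage, successor object to the six-change dictionary
(`FivePointSixChange.lean`, tree p368964: on the arc `A_a`, the five surviving boundary pattern probabilities are explicit crossing-event
probabilities of the hexagon `(z, y_{a+1}, …, y_a)`). As the boundary edge `z` ADVANCES along `A_a` (from the mark `v_a` towards
`v_{a+1}`, positions `p ≤ p'` of the boundary cycle), the sub-arc `∂_{y_a z}` (`arcToA`) grows and `∂_{z y_{a+1}}` (`arcFromA`) shrinks;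
the crossing events of the dictionary are monotone in these arcs, hence, for every five-marked domain `D : TriMarkedDomain 5` and every
colour `c`:

* `H_{a+1,A}` and `H_{a+1,B}` are NON-DECREASING along `A_a` (`patternProb_succ_A_mono`, `patternProb_succ_B_mono`);
* `H_{a,A}` and `H_{a,B}` are NON-INCREASING (`patternProb_self_A_anti`, `patternProb_self_B_anti`);
* consequently the sparse observables on the two rays move monotonically: `F_{a+2} = −τ·H_{a+1,B}` outward from `0` along `−τ·[0,1]`
  (`sparseObs_add_two_step`), `F_{a+4} = −τ²·H_{a,B}` inward to `0` along `−τ²·[0,1]` (`sparseObs_add_four_step`).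

(The fifth class `H_{a+3,A} = P[∂_{y_a z} ↔ A_{a+3} open ∧ ∂_{z y_{a+1}} ↔ A_{a+2} closed]` mixes a growing and a shrinking arc and is
not monotone: it vanishes towards both corners.) Bookkeeping: `arcToA_eq_image`, `arcFromA_eq_image` (the two sub-arcs as position
intervals `[pos a, p]`, `[p, nextPos a)`), `bdart_mem_stretch_iff`, `arcToA_mono`, `arcFromA_anti`, `crossS_mono_left/right`, `twoOf_mono`.

## References
* M. Khristoforov, S. Smirnov, *Percolation and O(1) loop model*, arXiv:2111.15612 (2021), §1.2 Lemma 2 (v1 pp. 2–3), §2 eq. (4) (p. 5)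
  — the three-disorder statements; the five-disorder boundary classes and their monotonicity are the lane's (not in print).
* B. Bollobás, O. Riordan, *Percolation*, CUP (2006), Ch. 7 §7.2.2 (pp. 191–195): marked discrete domains, arcs with both endpoints.

## Mathlib / tree
Mathlib: `MeasureTheory.measureReal_mono`. Tree: `FivePointSixChange.lean` (`Six.bdart`, `Six.arcToA`, `Six.arcFromA`, `Six.CrossS`,
`Six.TwoOf`, `Six.patternProb_succ_A/_succ_B/_self_A/_self_B`), `FivePointBoundaryValues.lean` (`Bdry.sparseObs_arc_add_two/_add_four`,
`Bdry.IsBoundaryEdge`), `FiveMarkedLoopStubs.lean` (`nextPos_le`, `nextPos_of_lt`, `pos_facts`), `TriDiscInterface.lean` (`dpos`, …).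
-/

open Finset MeasureTheory

namespace Literature.Probability.Percolation.FivePoint

namespace Six

open Literature.Probability.Percolation Literature.Probability.LatticeModels
open Literature.Probability.Percolation.FivePoint.N5
open Literature.Probability.Percolation.FivePoint.Bdry
open TriMarkedDomain

section Monotone

variable {D : TriMarkedDomain 5}

/-! ### positions of the darts of a stretch -/

/-- a dart of `A_a` sits at a position `pos a ≤ p < nextPos a ≤ L`, is `bdart p`, and is a boundary dart. [cite: BollobasRiordan2006, Ch. 7 §7.2.2 pp. 191–193] -/
theorem dpos_facts_of_mem_stretch {a : Fin 5} {d : Site 2 × Site 2} (hd : d ∈ D.stretch a) :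
    D.pos a ≤ D.dpos d ∧ D.dpos d < D.nextPos a ∧ D.dpos d < #(triBdryDarts D.verts) ∧ bdart D (D.dpos d) = d ∧
      d ∈ triBdryDarts D.verts := by
  unfold TriMarkedDomain.stretch at hd
  obtain ⟨n, hn, rfl⟩ := Finset.mem_image.1 hd
  rw [Finset.mem_Ico] at hn
  have hnL : n < #(triBdryDarts D.verts) := lt_of_lt_of_le hn.2 (nextPos_le D a)
  have hdp : D.dpos (triBdryIter D.verts D.base n) = n := by rw [D.dpos_iter, Nat.mod_eq_of_lt hnL]
  rw [hdp]
  exact ⟨hn.1, hn.2, hnL, rfl, bdart_mem n⟩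

/-- iterating from the marked dart of `A_a` walks the positions `pos a + t`. [cite: BollobasRiordan2006, Ch. 7 §7.2.2 pp. 191–193] -/
theorem iter_markDart_eq_bdart (a : Fin 5) (t : ℕ) : triBdryIter D.verts (D.markDart a) t = bdart D (D.pos a + t) := by
  show triBdryIter D.verts (triBdryIter D.verts D.base (D.pos a)) t = triBdryIter D.verts D.base (D.pos a + t)
  rw [← triBdryIter_add]

/-- iterating from a boundary dart walks the positions after it. [cite: BollobasRiordan2006, Ch. 7 §7.2.2 pp. 191–193] -/
theorem iter_eq_bdart_dpos_add {d : Site 2 × Site 2} (hd : d ∈ triBdryDarts D.verts) (t : ℕ) :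
    triBdryIter D.verts d t = bdart D (D.dpos d + t) := by
  conv_lhs => rw [← bdart_dpos hd]
  show triBdryIter D.verts (triBdryIter D.verts D.base (D.dpos d)) t = triBdryIter D.verts D.base (D.dpos d + t)
  rw [← triBdryIter_add]

/-- membership of `bdart m` in the stretch `A_a`, by position. [cite: BollobasRiordan2006, Ch. 7 §7.2.2 pp. 191–193] -/
theorem bdart_mem_stretch_iff (a : Fin 5) (m : ℕ) :
    bdart D m ∈ D.stretch a ↔ D.pos a ≤ m % #(triBdryDarts D.verts) ∧ m % #(triBdryDarts D.verts) < D.nextPos a := by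
  have hN : D.nextPos a ≤ #(triBdryDarts D.verts) := nextPos_le D a
  unfold TriMarkedDomain.stretch
  change bdart D m ∈ (Finset.Ico (D.pos a) (D.nextPos a)).image (fun n => triBdryIter D.verts D.base n) ↔ _
  simp only [Finset.mem_image, Finset.mem_Ico]
  constructor
  · rintro ⟨n, ⟨hn1, hn2⟩, h⟩
    have := D.isTriDisc.iter_eq_iter_iff.1 h
    rw [Nat.mod_eq_of_lt (by omega)] at this
    rw [← this]; exact ⟨hn1, hn2⟩
  · rintro ⟨h1, h2⟩
    exact ⟨m % #(triBdryDarts D.verts), ⟨h1, h2⟩, D.isTriDisc.iter_mod m⟩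

/-- ★ **`∂_{y_a z}` as a position interval**: the tails of the darts at positions `pos a, …, p`. [cite: KhristoforovSmirnov2021, §1.2 (arXiv v1 p. 2)] -/
theorem arcToA_eq_image {a : Fin 5} {g o : Site 2} (hd : (g, o) ∈ D.stretch a) :
    arcToA D a g o = ((Finset.Icc (D.pos a) (D.dpos (g, o))).image (bdart D)).image Prod.fst := by
  classical
  obtain ⟨hpa, -, hL, hbd, -⟩ := dpos_facts_of_mem_stretch hd
  have key : ∀ t, t < #(triBdryDarts D.verts) →
      ((∀ s < t, triBdryIter D.verts (D.markDart a) s ≠ (g, o)) ↔ t ≤ D.dpos (g, o) - D.pos a) := by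
    intro t ht
    constructor
    · intro h
      by_contra hlt
      push Not at hlt
      exact h _ hlt (by rw [iter_markDart_eq_bdart, Nat.add_sub_cancel' hpa, hbd])
    · intro h s hs heq
      rw [iter_markDart_eq_bdart] at heq
      have h1 : D.dpos (g, o) = D.pos a + s := D.dpos_eq_of_iter_eq (by omega) heq
      omega
  ext x
  unfold arcToA
  simp only [Finset.mem_image, Finset.mem_filter, Finset.mem_range, Finset.mem_Icc]
  constructor
  · rintro ⟨t, ⟨ht, hall⟩, rfl⟩
    have htle := (key t ht).1 hall
    exact ⟨bdart D (D.pos a + t), ⟨D.pos a + t, ⟨by omega, by omega⟩, rfl⟩, by rw [iter_markDart_eq_bdart]⟩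
  · rintro ⟨d, ⟨n, ⟨hn1, hn2⟩, rfl⟩, rfl⟩
    exact ⟨n - D.pos a, ⟨by omega, (key _ (by omega)).2 (by omega)⟩, by rw [iter_markDart_eq_bdart, Nat.add_sub_cancel' hn1]⟩

/-- ★ **`∂_{z y_{a+1}}` as a position interval**: the tails of the darts at positions `p, …, nextPos a − 1`.
[cite: KhristoforovSmirnov2021, §1.2 (arXiv v1 p. 2)] -/
theorem arcFromA_eq_image {a : Fin 5} {g o : Site 2} (hd : (g, o) ∈ D.stretch a) :
    arcFromA D a g o = ((Finset.Ico (D.dpos (g, o)) (D.nextPos a)).image (bdart D)).image Prod.fst := by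
  classical
  obtain ⟨hpa, hnext, hL, hbd, hmem⟩ := dpos_facts_of_mem_stretch hd
  have hN : D.nextPos a ≤ #(triBdryDarts D.verts) := nextPos_le D a
  -- the dart at position `nextPos a` is NOT in the stretch `A_a`
  have hout : bdart D (D.nextPos a) ∉ D.stretch a := by
    rw [bdart_mem_stretch_iff]
    rintro ⟨h1, h2⟩
    rcases lt_or_eq_of_le hN with hlt | heq
    · rw [Nat.mod_eq_of_lt hlt] at h2; exact lt_irrefl _ h2
    · rw [heq, Nat.mod_self] at h1
      -- `pos a = 0` forces `a = 0`, but then `nextPos 0 = pos 1 < L`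
      obtain ⟨h00, h01, h12, h23, h34, h4L⟩ := pos_facts D
      have ha : D.pos a = 0 := Nat.le_zero.1 h1
      have : a = 0 := by
        by_contra hne
        have hlt : (0 : Fin 5) < a := by
          rcases lt_or_eq_of_le (Fin.zero_le a) with h | h
          · exact h
          · exact absurd h.symm hne
        have := D.pos_strictMono hlt
        omega
      subst this
      rw [nextPos_of_lt D 0 (by decide)] at heq
      change D.pos 1 = _ at heq
      omega
  have key : ∀ t, t < #(triBdryDarts D.verts) →
      ((∀ s ≤ t, triBdryIter D.verts (g, o) s ∈ D.stretch a) ↔ D.dpos (g, o) + t < D.nextPos a) := by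
    intro t ht
    constructor
    · intro h
      by_contra hge
      push Not at hge
      have hs : D.nextPos a - D.dpos (g, o) ≤ t := by omega
      have := h _ hs
      rw [iter_eq_bdart_dpos_add hmem, show D.dpos (g, o) + (D.nextPos a - D.dpos (g, o)) = D.nextPos a by omega] at this
      exact hout this
    · intro h s hs
      rw [iter_eq_bdart_dpos_add hmem, bdart_mem_stretch_iff, Nat.mod_eq_of_lt (by omega)]
      exact ⟨by omega, by omega⟩
  ext x
  unfold arcFromA
  simp only [Finset.mem_image, Finset.mem_filter, Finset.mem_range, Finset.mem_Ico]
  constructor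
  · rintro ⟨t, ⟨ht, hall⟩, rfl⟩
    have hlt := (key t ht).1 hall
    exact ⟨bdart D (D.dpos (g, o) + t), ⟨D.dpos (g, o) + t, ⟨by omega, hlt⟩, rfl⟩, by rw [iter_eq_bdart_dpos_add hmem]⟩
  · rintro ⟨d, ⟨n, ⟨hn1, hn2⟩, rfl⟩, rfl⟩
    exact ⟨n - D.dpos (g, o), ⟨by omega, (key _ (by omega)).2 (by omega)⟩,
      by rw [iter_eq_bdart_dpos_add hmem, Nat.add_sub_cancel' hn1]⟩

/-! ### monotonicity of the sub-arcs and of the events -/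

/-- `∂_{y_a z}` grows with the position of `z`. [cite: KhristoforovSmirnov2021, §1.2 (arXiv v1 p. 2)] -/
theorem arcToA_mono {a : Fin 5} {g o g' o' : Site 2} (hd : (g, o) ∈ D.stretch a) (hd' : (g', o') ∈ D.stretch a)
    (hle : D.dpos (g, o) ≤ D.dpos (g', o')) : arcToA D a g o ⊆ arcToA D a g' o' := by
  rw [arcToA_eq_image hd, arcToA_eq_image hd']
  exact Finset.image_subset_image (Finset.image_subset_image (Finset.Icc_subset_Icc_right hle))

/-- `∂_{z y_{a+1}}` shrinks with the position of `z`. [cite: KhristoforovSmirnov2021, §1.2 (arXiv v1 p. 2)] -/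
theorem arcFromA_anti {a : Fin 5} {g o g' o' : Site 2} (hd : (g, o) ∈ D.stretch a) (hd' : (g', o') ∈ D.stretch a)
    (hle : D.dpos (g, o) ≤ D.dpos (g', o')) : arcFromA D a g' o' ⊆ arcFromA D a g o := by
  rw [arcFromA_eq_image hd, arcFromA_eq_image hd']
  exact Finset.image_subset_image (Finset.image_subset_image (Finset.Ico_subset_Ico_left hle))

/-- the crossing event `X ↔ Y` is monotone in `X`. [folklore] -/
private theorem crossS_mono_left {σ : Set (Site 2)} {b : Bool} {X X' Y : Finset (Site 2)} (h : X ⊆ X') :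
    CrossS D σ b X Y → CrossS D σ b X' Y := by
  rintro ⟨x, hx, y, hy, hp⟩; exact ⟨x, h hx, y, hy, hp⟩

/-- the crossing event `X ↔ Y` is monotone in `Y`. [folklore] -/
private theorem crossS_mono_right {σ : Set (Site 2)} {b : Bool} {X Y Y' : Finset (Site 2)} (h : Y ⊆ Y') :
    CrossS D σ b X Y → CrossS D σ b X Y' := by
  rintro ⟨x, hx, y, hy, hp⟩; exact ⟨x, hx, y, h hy, hp⟩

/-- «at least two of three» is monotone. [folklore] -/
private theorem twoOf_mono {P P' Q Q' R R' : Prop} (hP : P → P') (hQ : Q → Q') (hR : R → R') : TwoOf P Q R → TwoOf P' Q' R' := by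
  rintro (⟨p, q⟩ | ⟨q, r⟩ | ⟨r, p⟩)
  · exact Or.inl ⟨hP p, hQ q⟩
  · exact Or.inr (Or.inl ⟨hQ q, hR r⟩)
  · exact Or.inr (Or.inr ⟨hR r, hP p⟩)

section TwoEdges

variable {a : Fin 5} {g o g' o' : Site 2} (hd : (g, o) ∈ D.stretch a) (hd' : (g', o') ∈ D.stretch a)
  (hle : D.dpos (g, o) ≤ D.dpos (g', o'))
  {x x' y y' : HexVertex} (hxx : hexGraph.Adj x x') (hex : faceEdge x x' = {g, o})
  (hyy : hexGraph.Adj y y') (hey : faceEdge y y' = {g', o'})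
include hd hd' hle hxx hex hyy hey

/-- ★ **`H_{a+1,A}` is non-decreasing along `A_a`.** [cite: KhristoforovSmirnov2021, §1.2 Lemma 2 (pp. 2–3), five-disorder analogue] -/
theorem patternProb_succ_A_mono (c : Bool) : patternProb D (a + 1) c false x x' ≤ patternProb D (a + 1) c false y y' := by
  rw [patternProb_succ_A hd hxx hex c, patternProb_succ_A hd' hyy hey c]
  refine measureReal_mono (fun σ hσ => ?_) (measure_ne_top _ _)
  have hsub := arcToA_mono hd hd' hle
  exact twoOf_mono (crossS_mono_left hsub) id (crossS_mono_right hsub) hσ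

/-- ★ **`H_{a+1,B}` is non-decreasing along `A_a`.** [cite: KhristoforovSmirnov2021, §1.2 Lemma 2 (pp. 2–3), five-disorder analogue] -/
theorem patternProb_succ_B_mono (c : Bool) : patternProb D (a + 1) c true x x' ≤ patternProb D (a + 1) c true y y' := by
  rw [patternProb_succ_B hd hxx hex c, patternProb_succ_B hd' hyy hey c]
  refine measureReal_mono (fun σ hσ => ?_) (measure_ne_top _ _)
  exact ⟨crossS_mono_left (arcToA_mono hd hd' hle) hσ.1, hσ.2⟩

/-- ★ **`H_{a,A}` is non-increasing along `A_a`.** [cite: KhristoforovSmirnov2021, §1.2 Lemma 2 (pp. 2–3), five-disorder analogue] -/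
theorem patternProb_self_A_anti (c : Bool) : patternProb D a c false y y' ≤ patternProb D a c false x x' := by
  rw [patternProb_self_A hd hxx hex c, patternProb_self_A hd' hyy hey c]
  refine measureReal_mono (fun σ hσ => ?_) (measure_ne_top _ _)
  have hsub := arcFromA_anti hd hd' hle
  exact twoOf_mono (crossS_mono_left hsub) id (crossS_mono_right hsub) hσ

/-- ★ **`H_{a,B}` is non-increasing along `A_a`.** [cite: KhristoforovSmirnov2021, §1.2 Lemma 2 (pp. 2–3), five-disorder analogue] -/
theorem patternProb_self_B_anti (c : Bool) : patternProb D a c true y y' ≤ patternProb D a c true x x' := by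
  rw [patternProb_self_B hd hxx hex c, patternProb_self_B hd' hyy hey c]
  refine measureReal_mono (fun σ hσ => ?_) (measure_ne_top _ _)
  exact ⟨crossS_mono_left (arcFromA_anti hd hd' hle) hσ.1, hσ.2⟩

/-- ★ **`F_{a+2}` moves outward along the ray `−τ·[0, 1]`**: `F_{a+2}(z') − F_{a+2}(z) = −τ·t` with `0 ≤ t`.
[cite: KhristoforovSmirnov2021, §2 eq. (4) (arXiv v1 p. 5), five-disorder analogue] -/
theorem sparseObs_add_two_step (c : Bool) : ∃ t : ℝ, 0 ≤ t ∧
    sparseObs D (a + 2) c y y' - sparseObs D (a + 2) c x x' = -(tau * (t : ℂ)) := by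
  refine ⟨patternProb D (a + 1) c true y y' - patternProb D (a + 1) c true x x',
    sub_nonneg.2 (patternProb_succ_B_mono hd hd' hle hxx hex hyy hey c), ?_⟩
  rw [sparseObs_arc_add_two (isBoundaryEdge_of_stretch hd hxx hex) c, sparseObs_arc_add_two (isBoundaryEdge_of_stretch hd' hyy hey) c]
  push_cast
  ring

/-- ★ **`F_{a+4}` moves inward along the ray `−τ²·[0, 1]`**: `F_{a+4}(z') − F_{a+4}(z) = +τ²·t` with `0 ≤ t`.
[cite: KhristoforovSmirnov2021, §2 eq. (4) (arXiv v1 p. 5), five-disorder analogue] -/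
theorem sparseObs_add_four_step (c : Bool) : ∃ t : ℝ, 0 ≤ t ∧
    sparseObs D (a + 4) c y y' - sparseObs D (a + 4) c x x' = tau ^ 2 * (t : ℂ) := by
  refine ⟨patternProb D a c true x x' - patternProb D a c true y y',
    sub_nonneg.2 (patternProb_self_B_anti hd hd' hle hxx hex hyy hey c), ?_⟩
  rw [sparseObs_arc_add_four (isBoundaryEdge_of_stretch hd hxx hex) c, sparseObs_arc_add_four (isBoundaryEdge_of_stretch hd' hyy hey) c]
  push_cast
  ring

end TwoEdges

end Monotone

end Six

end Literature.Probability.Percolation.FivePoint
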